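import Literature.NumberTheory.EllipticCurves.BhargavaShankarLocalWeightConstancyProofs
import Literature.NumberTheory.EllipticCurves.BhargavaShankarLocalMassesProofs
import HarnessLib

/-!
# The local sieve weight `φ_p = 1_{ℚ_p-soluble} · 1_{F_p^{inv}} / m_p` of Bhargava–Shankar is
# locally constant off `Δ = 0`

`Proofs` companion (theorems only: no definitions, no named facts). Source: M. Bhargava, A. Shankar,
*Binary quartic forms having bounded invariants, and the boundedness of the average rank of elliptic
curves*, Ann. of Math. (2) 181 (2015) 191–242, published version (= `arXiv:1006.1002v3`), proof of
Thm 3.19 (the sieve step (†) `bhargavaShankar_locSolIrredClassCount_asymptotic` of the tree): the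
weighted count of `PGL₂(ℤ)`-orbits of locally soluble integral forms with invariants in
`2⁴·F^{inv} × 2⁶·F^{inv}` is `N_φ(V_ℤ; X)` for `φ = ∏_p φ_p`,
`φ_p(f) = 1_{f ℚ_p-soluble} · 1_{(I(f),J(f)) ∈ 2⁴F_p^{inv} × 2⁶F_p^{inv}} / m_p(f)`, and Thm 2.21 is
applied to `φ`, which requires `φ` to be *acceptable* (§2.7): each `φ_p` "locally constant outside
some closed set … of measure zero". The source does not verify this hypothesis; here it is proved,
with the closed null set `{Δ = 0}` (`BinaryQuartic.isClosed` of a polynomial zero set, null by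
`Literature.NumberTheory.EllipticCurves.BinaryQuartic.padicInt_volume_setOf_disc_eq_zero`), from
the three regularity statements of the tree:

* `ℚ_p`-solubility is locally constant off `Δ = 0` (`BinaryQuartic.eventually_isSoluble_iff`,
  `BinaryQuarticLocalSolubility.lean`);
* `m_p` is locally constant off `Δ = 0` (`BinaryQuartic.eventually_localWeight_eq`,
  `BhargavaShankarLocalWeightConstancyProofs.lean`);
* the invariant condition is locally constant everywhere: `F_p^{inv}` (`invariantPairsAdic p`, equal
  to the closure `invariantPairsAdicClosure p` by `invariantPairsAdicClosure_eq`) is **open and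
  closed** in `ℤ_p²` (`isClopen_invariantPairsAdic`), so is its scaled copy
  `2⁴F_p^{inv} × 2⁶F_p^{inv}` (`isClopen_image_scale`), and `f ↦ (I(f), J(f))` is continuous.

Main statements: `BinaryQuartic.eventually_invariants_mem_iff`,
`BinaryQuartic.eventually_sievePhi_data_eq` (solubility, invariant condition and `m_p` are
simultaneously constant near any `f` with `Δ(f) ≠ 0`) and `BinaryQuartic.eventually_sievePhi_eq`
(the function `φ_p`, written out, is locally constant on `{Δ ≠ 0}`).

## References

* M. Bhargava, A. Shankar, Ann. of Math. (2) 181 (2015) 191–242, §2.7 (acceptable functions,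
  Thm 2.21) and §3.6, proof of Thm 3.19, of the published version.
  [cite: BhargavaShankarAnnals2015, §2.7 and proof of Thm 3.19 (acceptability of φ; published numbering)]
-/

noncomputable section

open scoped Classical Topology
open Filter Set

namespace Literature.NumberTheory.EllipticCurves

section Padic

variable (p : ℕ) [Fact p.Prime]

/-! ## Clopen sets in `ℤ_p` and `ℤ_p²` -/

/-- `{x ∈ ℤ_p : pᵏ ∣ x}` is the closed ball of radius `p⁻ᵏ`, open and closed. [folklore] -/
theorem isClopen_setOf_pow_dvd (k : ℕ) : IsClopen {x : ℤ_[p] | (p : ℤ_[p]) ^ k ∣ x} := by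
  have : {x : ℤ_[p] | (p : ℤ_[p]) ^ k ∣ x} = Metric.closedBall (0 : ℤ_[p]) ((p : ℝ) ^ (-(k : ℤ))) := by
    ext x
    simp only [mem_setOf_eq, Metric.mem_closedBall, dist_zero_right]
    rw [PadicInt.norm_le_pow_iff_mem_span_pow, Ideal.mem_span_singleton]
  rw [this]
  exact IsUltrametricDist.isClopen_closedBall _ (zpow_pos (by exact_mod_cast (Fact.out : p.Prime).pos) _).ne'

/-- The principal ideal of a nonzero `a ∈ ℤ_p` is `p^{v(a)}ℤ_p`: `{a·y} = {x : p^{v(a)} ∣ x}`. [folklore] -/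
theorem range_mul_eq_setOf_pow_dvd {a : ℤ_[p]} (ha : a ≠ 0) :
    range (fun y : ℤ_[p] ↦ a * y) = {x : ℤ_[p] | (p : ℤ_[p]) ^ a.valuation ∣ x} := by
  have hspec := PadicInt.unitCoeff_spec ha
  set u : ℤ_[p]ˣ := PadicInt.unitCoeff ha with hu
  ext x
  simp only [mem_range, mem_setOf_eq]
  constructor
  · rintro ⟨y, rfl⟩
    refine ⟨(u : ℤ_[p]) * y, ?_⟩
    calc a * y = ((u : ℤ_[p]) * (p : ℤ_[p]) ^ a.valuation) * y := by rw [← hspec]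
      _ = (p : ℤ_[p]) ^ a.valuation * ((u : ℤ_[p]) * y) := by ring
  · rintro ⟨z, rfl⟩
    refine ⟨((u⁻¹ : ℤ_[p]ˣ) : ℤ_[p]) * z, ?_⟩
    calc a * (((u⁻¹ : ℤ_[p]ˣ) : ℤ_[p]) * z)
        = ((u : ℤ_[p]) * (p : ℤ_[p]) ^ a.valuation) * (((u⁻¹ : ℤ_[p]ˣ) : ℤ_[p]) * z) := by rw [← hspec]
      _ = ((u : ℤ_[p]) * ((u⁻¹ : ℤ_[p]ˣ) : ℤ_[p])) * ((p : ℤ_[p]) ^ a.valuation * z) := by ring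
      _ = (p : ℤ_[p]) ^ a.valuation * z := by rw [Units.mul_inv, one_mul]

/-- **Scaling preserves clopen sets**: for nonzero `a, b ∈ ℤ_p` and a clopen `S ⊆ ℤ_p²`, the set
`{(a·I, b·J) : (I, J) ∈ S}` is clopen (closed as a compact image; open as the difference of the
clopen `aℤ_p × bℤ_p` and the closed image of `Sᶜ`). [folklore] -/
theorem isClopen_image_scale {S : Set (ℤ_[p] × ℤ_[p])} (hS : IsClopen S) {a b : ℤ_[p]} (ha : a ≠ 0) (hb : b ≠ 0) :
    IsClopen ((fun IJ : ℤ_[p] × ℤ_[p] ↦ (a * IJ.1, b * IJ.2)) '' S) := by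
  set m : ℤ_[p] × ℤ_[p] → ℤ_[p] × ℤ_[p] := fun IJ ↦ (a * IJ.1, b * IJ.2) with hm
  have hcont : Continuous m := by fun_prop
  have hinj : Function.Injective m := by
    rintro ⟨I, J⟩ ⟨I', J'⟩ h
    simp only [hm, Prod.mk.injEq] at h
    exact Prod.ext (mul_left_cancel₀ ha h.1) (mul_left_cancel₀ hb h.2)
  have hclosed : ∀ T : Set (ℤ_[p] × ℤ_[p]), IsClosed T → IsClosed (m '' T) := fun T hT ↦
    (hT.isCompact.image hcont).isClosed
  refine ⟨hclosed S hS.isClosed, ?_⟩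
  -- `m '' S = range m \\ m '' Sᶜ`
  have hrange : range m = {x : ℤ_[p] | (p : ℤ_[p]) ^ a.valuation ∣ x} ×ˢ {x : ℤ_[p] | (p : ℤ_[p]) ^ b.valuation ∣ x} := by
    rw [← range_mul_eq_setOf_pow_dvd p ha, ← range_mul_eq_setOf_pow_dvd p hb,
      show m = Prod.map (fun x : ℤ_[p] ↦ a * x) (fun y : ℤ_[p] ↦ b * y) from rfl, Set.range_prodMap]
  have heq : m '' S = range m \ m '' Sᶜ := by
    rw [← Set.image_univ, ← Set.image_sdiff hinj, Set.sdiff_compl, Set.univ_inter]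
  rw [heq, hrange]
  exact (((isClopen_setOf_pow_dvd p _).isOpen.prod (isClopen_setOf_pow_dvd p _).isOpen)).sdiff
    (hclosed _ hS.compl.isClosed)

/-- `{(A, B) : p⁴ ∤ A or p⁶ ∤ B}` is open and closed. [folklore] -/
theorem isClopen_minimalPairsAdic : IsClopen (minimalPairsAdic p) := by
  have : minimalPairsAdic p = ({A : ℤ_[p] | (p : ℤ_[p]) ^ 4 ∣ A} ×ˢ {B : ℤ_[p] | (p : ℤ_[p]) ^ 6 ∣ B})ᶜ := by
    ext AB; rfl
  rw [this]
  exact ((isClopen_setOf_pow_dvd p 4).prod (isClopen_setOf_pow_dvd p 6)).compl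

/-- **`F_p^{inv}` is open and closed in `ℤ_p²`** (for the family of all elliptic curves): for
`p ≠ 3` it is `{p⁴ ∤ I or p⁶ ∤ J}`, for `p = 3` it is `{3 ∣ I, 27 ∣ J} ∖ {3⁵ ∣ I, 3⁹ ∣ J}`.
[cite: BhargavaShankarAnnals2015, §3.6, proof of Thm 3.19 (F_p^{inv}; published numbering)] -/
theorem isClopen_invariantPairsAdic : IsClopen (invariantPairsAdic p) := by
  by_cases hp3 : p = 3
  · subst hp3
    rw [invariantPairsAdic_three]
    exact ((isClopen_setOf_pow_dvd 3 1).prod (isClopen_setOf_pow_dvd 3 3)).diff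
      ((isClopen_setOf_pow_dvd 3 5).prod (isClopen_setOf_pow_dvd 3 9))
  · rw [invariantPairsAdic_eq_of_ne_three p hp3]
    exact isClopen_minimalPairsAdic p

/-- Hence so is `F_p^{inv}` in its closure form. [cite: BhargavaShankarAnnals2015, §3.6, proof of Thm 3.19 (published numbering)] -/
theorem isClopen_invariantPairsAdicClosure : IsClopen (invariantPairsAdicClosure p) := by
  rw [invariantPairsAdicClosure_eq]; exact isClopen_invariantPairsAdic p

/-- **The scaled set `2⁴F_p^{inv} × 2⁶F_p^{inv} = {(2⁴I, 2⁶J) : (I,J) ∈ F_p^{inv}}` is open and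
closed** (the invariant condition on `f` in `S^F`: `(I(f), J(f)) = (2⁴I, 2⁶J)`, `(I,J) ∈ F_p^{inv}`).
[cite: BhargavaShankarAnnals2015, §3.6, proof of Thm 3.19 (published numbering)] -/
theorem isClopen_image_invariantPairsAdic :
    IsClopen ((fun IJ : ℤ_[p] × ℤ_[p] ↦ ((2 : ℤ_[p]) ^ 4 * IJ.1, (2 : ℤ_[p]) ^ 6 * IJ.2)) '' invariantPairsAdic p) :=
  isClopen_image_scale p (isClopen_invariantPairsAdic p) (pow_ne_zero _ two_ne_zero) (pow_ne_zero _ two_ne_zero)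

namespace BinaryQuartic

/-! ## The invariant condition is locally constant -/

/-- `I` is continuous on `V_R`. [folklore] -/
@[fun_prop]
theorem continuous_I {R : Type*} [CommRing R] [TopologicalSpace R] [IsTopologicalRing R] :
    Continuous fun f : BinaryQuartic R ↦ f.I := by
  simp only [I]; fun_prop

/-- `J` is continuous on `V_R`. [folklore] -/
@[fun_prop]
theorem continuous_J {R : Type*} [CommRing R] [TopologicalSpace R] [IsTopologicalRing R] :
    Continuous fun f : BinaryQuartic R ↦ f.J := by
  simp only [J]; fun_prop

/-- Membership of `(I(f), J(f))` in a clopen set is locally constant in `f`. [folklore] -/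
theorem eventually_invariants_mem_iff {S : Set (ℤ_[p] × ℤ_[p])} (hS : IsClopen S) (f : BinaryQuartic ℤ_[p]) :
    ∀ᶠ f' in 𝓝 f, ((f'.I, f'.J) ∈ S ↔ (f.I, f.J) ∈ S) := by
  have hcont : Continuous fun g : BinaryQuartic ℤ_[p] ↦ (g.I, g.J) := by fun_prop
  by_cases hf : (f.I, f.J) ∈ S
  · filter_upwards [hcont.continuousAt.preimage_mem_nhds (hS.isOpen.mem_nhds hf)] with f' hf'
    exact iff_of_true hf' hf
  · filter_upwards [hcont.continuousAt.preimage_mem_nhds (hS.compl.isOpen.mem_nhds hf)] with f' hf'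
    exact iff_of_false hf' hf

/-- The invariant condition of `S^F` at `p`, "`(I(f), J(f)) ∈ 2⁴F_p^{inv} × 2⁶F_p^{inv}`", is locally
constant in `f ∈ V_{ℤ_p}`. [cite: BhargavaShankarAnnals2015, §3.6, proof of Thm 3.19 (published numbering)] -/
theorem eventually_exists_invariantPairsAdic_iff (f : BinaryQuartic ℤ_[p]) :
    ∀ᶠ f' in 𝓝 f, ((∃ IJ ∈ invariantPairsAdic p, f'.I = 2 ^ 4 * IJ.1 ∧ f'.J = 2 ^ 6 * IJ.2) ↔
      (∃ IJ ∈ invariantPairsAdic p, f.I = 2 ^ 4 * IJ.1 ∧ f.J = 2 ^ 6 * IJ.2)) := by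
  have key : ∀ g : BinaryQuartic ℤ_[p], (∃ IJ ∈ invariantPairsAdic p, g.I = 2 ^ 4 * IJ.1 ∧ g.J = 2 ^ 6 * IJ.2) ↔
      (g.I, g.J) ∈ (fun IJ : ℤ_[p] × ℤ_[p] ↦ ((2 : ℤ_[p]) ^ 4 * IJ.1, (2 : ℤ_[p]) ^ 6 * IJ.2)) '' invariantPairsAdic p :=
    fun g ↦ by
      simp only [mem_image, Prod.mk.injEq]
      constructor
      · rintro ⟨IJ, hIJ, h1, h2⟩; exact ⟨IJ, hIJ, h1.symm, h2.symm⟩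
      · rintro ⟨IJ, hIJ, h1, h2⟩; exact ⟨IJ, hIJ, h1.symm, h2.symm⟩
  simp only [key]
  exact eventually_invariants_mem_iff p (isClopen_image_invariantPairsAdic p) f

/-! ## `φ_p` is locally constant off `Δ = 0` -/

/-- **Near a form with `Δ ≠ 0`, `ℚ_p`-solubility, the invariant condition and `m_p` are all
constant.** [cite: BhargavaShankarAnnals2015, §2.7 and proof of Thm 3.19 (acceptability of φ; published numbering)] -/
theorem eventually_sievePhi_data_eq (f : BinaryQuartic ℤ_[p]) (hΔ : f.disc ≠ 0) :
    ∀ᶠ f' in 𝓝 f,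
      ((f'.map PadicInt.Coe.ringHom).IsSoluble ↔ (f.map PadicInt.Coe.ringHom).IsSoluble) ∧
      ((∃ IJ ∈ invariantPairsAdic p, f'.I = 2 ^ 4 * IJ.1 ∧ f'.J = 2 ^ 6 * IJ.2) ↔
        (∃ IJ ∈ invariantPairsAdic p, f.I = 2 ^ 4 * IJ.1 ∧ f.J = 2 ^ 6 * IJ.2)) ∧
      localWeight f' = localWeight f ∧ f'.disc ≠ 0 := by
  have hopen : {f' : BinaryQuartic ℤ_[p] | f'.disc ≠ 0} ∈ 𝓝 f :=
    (isOpen_ne_fun continuous_disc continuous_const).mem_nhds hΔ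
  filter_upwards [eventually_isSoluble_iff f hΔ, eventually_exists_invariantPairsAdic_iff p f,
    eventually_localWeight_eq f hΔ, hopen] with f' h1 h2 h3 h4
  exact ⟨h1, h2, h3, h4⟩

/-- **`φ_p` is locally constant on `{Δ ≠ 0}`**: the local sieve weight
`φ_p(f) = 1/m_p(f)` if `f` is `ℚ_p`-soluble with `(I(f), J(f)) ∈ 2⁴F_p^{inv} × 2⁶F_p^{inv}`, and `0`
otherwise, satisfies `φ_p(f') = φ_p(f)` for all `f'` near any `f` with `Δ(f) ≠ 0` — the
acceptability hypothesis of Thm 2.21 for the function `φ = ∏_p φ_p` of the proof of Thm 3.19, the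
exceptional closed set `{Δ = 0}` being null (`padicInt_volume_setOf_disc_eq_zero`).
[cite: BhargavaShankarAnnals2015, §2.7 and proof of Thm 3.19 (acceptability of φ; published numbering)] -/
theorem eventually_sievePhi_eq (f : BinaryQuartic ℤ_[p]) (hΔ : f.disc ≠ 0) :
    ∀ᶠ f' in 𝓝 f,
      (if (f'.map PadicInt.Coe.ringHom).IsSoluble ∧
          (∃ IJ ∈ invariantPairsAdic p, f'.I = 2 ^ 4 * IJ.1 ∧ f'.J = 2 ^ 6 * IJ.2)
        then (1 : ℝ) / localWeight f' else 0) =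
      (if (f.map PadicInt.Coe.ringHom).IsSoluble ∧
          (∃ IJ ∈ invariantPairsAdic p, f.I = 2 ^ 4 * IJ.1 ∧ f.J = 2 ^ 6 * IJ.2)
        then (1 : ℝ) / localWeight f else 0) := by
  filter_upwards [eventually_sievePhi_data_eq p f hΔ] with f' h
  obtain ⟨h1, h2, h3, -⟩ := h
  rw [h3]
  simp only [h1, h2]

/-- The exceptional set `{Δ = 0}` is closed in `V_{ℤ_p}`. [folklore] -/
theorem isClosed_setOf_disc_eq_zero : IsClosed {f : BinaryQuartic ℤ_[p] | f.disc = 0} :=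
  isClosed_eq continuous_disc continuous_const

end BinaryQuartic

end Padic

end Literature.NumberTheory.EllipticCurves

end
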